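import Mathlib
import Summits.Ventures.PercRepro.TriangleCapCapGenRef

/-!
# PercRepro — TOWARDS EVERY CELL `(k, a, a + j)`: THE COUNTS AT THE CAP FOR A GENERAL `j` (p3, gen 48; part 202b)

`capGen_noedge`: no edge inside the `a − 1` non-neighbours `R` of a vertex of degree `K = k − a` once `K ≥ 2a + j`
(the linear relaxation of part 200zk with the deficit `j`: an edge `u v` inside `R` has `P_u + P_v ≤ K + 1` and
`d_R ≤ a − 2` at its ends, which forces `K ≤ 2a + j − 1`). `capGen_matching`: `E = 0` and the count
`2(a − 1) K − 2 (a + j) = 2M + 2P` give `(a − 2) M ≤ a + j`, so `M ≤ 1` for `a ≥ j + 5`. Axioms: standard.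
-/

namespace PercRepro

namespace TriangleCap

namespace C047

/-- **NO EDGE INSIDE `R` FOR `K ≥ 2a + j`** (`a = a' + 5`): the degree count with an edge `u v` inside `R`. -/
theorem capGen_noedge (a' j K M P E m Pu Pv Pr du dv dr : ℕ) (hK : 2 * (a' + 5) + j ≤ K)
    (hdeg : K + (K + 2 * M + P) + (P + E) = 2 * m) (hm : m + (a' + 5 + j) = (a' + 5) * K)
    (h1 : P + E ≤ (a' + 4) * K) (hPuv : Pu + Pv ≤ K + 1) (hrest : Pr + (a' + 2) * M ≤ (a' + 2) * K)
    (hP : P = Pu + Pv + Pr) (hE : E = du + dv + dr) (hu : Pu + du ≤ K) (hv : Pv + dv ≤ K)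
    (hr : Pr + dr ≤ (a' + 2) * K) (hdu : du ≤ a' + 3) (hdv : dv ≤ a' + 3) : False := by
  subst hP hE
  obtain ⟨t, rfl⟩ : ∃ t, K = 2 * (a' + 5) + j + t := ⟨K - (2 * (a' + 5) + j), by omega⟩
  nlinarith [hdeg, hm, h1, hPuv, hrest, hu, hv, hr, hdu, hdv, Nat.zero_le (a' * M), Nat.zero_le (t * M),
    Nat.zero_le (a' * t), Nat.zero_le (j * M), Nat.zero_le (a' * j), Nat.zero_le (j * t)]

/-- `(a − 2) M ≤ a + j` (`a = a' + 5`) ⇒ `M ≤ 1` for `j ≤ a'`. -/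
theorem capGen_matching (a' j K M P m : ℕ) (hj : j ≤ a') (hdeg : K + (K + 2 * M + P) + (P + 0) = 2 * m)
    (hm : m + (a' + 5 + j) = (a' + 5) * K) (h2 : P + (a' + 4) * M ≤ (a' + 4) * K) : M ≤ 1 := by
  have key : (a' + 3) * M ≤ a' + 5 + j := by nlinarith [hdeg, hm, h2]
  by_contra hM
  have hM2 : 2 ≤ M := by omega
  have := Nat.mul_le_mul_left (a' + 3) hM2
  omega

end C047

end TriangleCap

end PercRepro
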